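import Summits.FinalStateConjecture.FinalStateConjecture.Theorems.PhotonSphereChannelsKerrDevDefs
import HarnessLib

/-!
# Route PhotonSphereChannels · crux `ChannelsResolveTameDevelopmentsR` (K2R) — hull elements along
# subsequences: reindexing a pointed `Cᵏ_loc` datum onto its own subsequence
# (line `kerr-isolation-dichotomy`; supports stub S1 `stub_silentHullExtraction`)

`Spacetime.SubconvergesLocallyTo 𝓢ₙ pₙ 𝓢 p k` (Literature `SpacetimeLocalConvergence.lean`) says that
SOME subsequence of the pointed spacetimes converges; the subsequence `D.sub` is hidden inside the
datum. Stub S1 of the line must deliver its deviation dictionary along the extraction `q ∘ φ` for ALL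
large `n`, so the extraction has to ABSORB the hidden subsequence. This file provides the bookkeeping:

* `nonempty_localSubconvergence_comp_sub D` — the datum `D` reindexed onto its own subsequence: the
  pointed spacetimes `(𝓢ₙ (D.sub n), pₙ (D.sub n))` converge to the same limit with the same exhaustion and
  comparison maps and subsequence `id` (every field is `D`'s; stated as `Nonempty` of the datum type, so
  that no new definition enters the tree);
* `subconvergesLocallyTo_comp_sub` — for a constant family, `(𝓣, q (D.sub (ρ n))) ⇀ (𝓢, p)` for every
  further strictly increasing `ρ` (with `LocalSubconvergence.subseq`);
* `subconvergesLocallyTo_exists_extraction`, `isHullElement_exists_extraction` — `Prop` forms: a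
  subconvergent sequence (resp. a hull element) admits an extraction `φ` ALL of whose further
  subsequences are again subconvergent (resp. hull elements with the same limit, end datum and base
  point) — the form used in diagonal arguments (S1's dictionary, S5's band statement).

Everything is proved; there are no definitions.
Reference: Petersen, *Riemannian Geometry*, 2nd ed., Ch. 10 §3.2 (pointed convergence; passing to
subsequences) [Petersen2006]; Anderson gr-qc/0208079, Def. 1.1 [Anderson2004].
-/

noncomputable section

-- the operator-norm instance on `E4 →L[ℝ] E4 →L[ℝ] ℝ` needs one more level of pending
-- instance problems than the default (as in `PhotonSphereChannelsKerrDevDefs.lean`)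
set_option maxSynthPendingDepth 3
-- every `Summit.FinalStateConjecture.FinalStateConjecture.…` name repeats the summit = sub-problem segment (D-0017 layout)
set_option linter.dupNamespace false

open Set Filter Function TopologicalSpace Manifold Bundle
open scoped Topology Manifold ContDiff ENNReal NNReal

universe u v

namespace Summit.FinalStateConjecture.FinalStateConjecture.Theorems

open Literature.Geometry.Lorentzian
open Summit.FinalStateConjecture.FinalStateConjecture.Theorems.TameHull

/-! ### Reindexing a datum onto its own subsequence -/

/-- **The subconvergence datum `D` reindexed onto its own subsequence** (term-level, kept private to this
file's proofs: no new definition is introduced). If `(𝓢ₙ n, pₙ n) ⇀ (𝓢, p)` in the pointed `Cᵏ` sense with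
datum `D` (subsequence `D.sub`), then the reindexed pointed spacetimes `(𝓢ₙ (D.sub n), pₙ (D.sub n))`
converge to `(𝓢, p)` with subsequence `id`, the same exhaustion `D.U` and the same comparison maps
`D.embed` (every field is `D`'s). Petersen 2006, Ch. 10 §3.2. [cite: Petersen2006, Ch. 10 §3.2] -/
theorem nonempty_localSubconvergence_comp_sub : ∀ {𝓢ₙ : ℕ → Spacetime.{0} 4} {pₙ : ∀ n, (𝓢ₙ n).carrier} {𝓢 : Spacetime.{0} 4} {p : 𝓢.carrier} {k : ℕ} (D : Spacetime.LocalSubconvergence 𝓢ₙ pₙ 𝓢 p k), Nonempty (Spacetime.LocalSubconvergence (fun n ↦ 𝓢ₙ (D.sub n)) (fun n ↦ pₙ (D.sub n)) 𝓢 p k) :=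
  fun D ↦
  ⟨{ sub := id
     strictMono_sub := strictMono_id
     U := D.U
     monotone_U := D.monotone_U
     mem_U := D.mem_U
     iUnion_U := D.iUnion_U
     isCompact_closure_U := D.isCompact_closure_U
     embed := D.embed
     isLocalDiffeomorphOn_embed := D.isLocalDiffeomorphOn_embed
     injOn_embed := D.injOn_embed
     embed_basepoint := D.embed_basepoint
     isFutureDirected_mfderiv_embed := D.isFutureDirected_mfderiv_embed
     tendsto_supCkENorm := D.tendsto_supCkENorm }⟩

/-! ### Constant families: subconvergence and hull elements along the extracted subsequence -/

/-- **A constant family subconverges along (every further subsequence of) the datum's own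
subsequence**: `(𝓣, q (D.sub (ρ n))) ⇀ (𝓢, p)` for every strictly increasing `ρ`
(`LocalSubconvergence.subseq` then `nonempty_localSubconvergence_comp_sub`). [cite: Petersen2006, Ch. 10 §3.2] -/
theorem subconvergesLocallyTo_comp_sub : ∀ {𝓣 : Spacetime.{0} 4} {q : ℕ → 𝓣.carrier} {𝓢 : Spacetime.{0} 4} {p : 𝓢.carrier} {k : ℕ} (D : Spacetime.LocalSubconvergence (fun _ ↦ 𝓣) q 𝓢 p k) (ρ : ℕ → ℕ), StrictMono ρ → Spacetime.SubconvergesLocallyTo (fun _ ↦ 𝓣) (q ∘ D.sub ∘ ρ) 𝓢 p k :=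
  fun D ρ hρ ↦ nonempty_localSubconvergence_comp_sub (D.subseq ρ hρ)

/-- **Extraction form of subconvergence** for a constant family: a subconvergent pointed sequence
admits an extraction `φ` such that `q ∘ φ ∘ ρ` subconverges to the same pointed limit for EVERY
strictly increasing `ρ` (the hidden subsequence absorbed; ready for diagonal arguments).
[cite: Petersen2006, Ch. 10 §3.2] -/
theorem subconvergesLocallyTo_exists_extraction : ∀ {𝓣 : Spacetime.{0} 4} {q : ℕ → 𝓣.carrier} {𝓢 : Spacetime.{0} 4} {p : 𝓢.carrier} {k : ℕ}, Spacetime.SubconvergesLocallyTo (fun _ ↦ 𝓣) q 𝓢 p k → ∃ φ : ℕ → ℕ, StrictMono φ ∧ ∀ ρ : ℕ → ℕ, StrictMono ρ → Spacetime.SubconvergesLocallyTo (fun _ ↦ 𝓣) (q ∘ φ ∘ ρ) 𝓢 p k :=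
  fun ⟨D⟩ ↦ ⟨D.sub, D.strictMono_sub, fun ρ hρ ↦ subconvergesLocallyTo_comp_sub D ρ hρ⟩

/-- **Hull elements admit extractions all of whose subsequences are hull elements** (same limit,
end datum and base point): future-escaping passes to subsequences (`IsFutureEscaping.comp_tendsto`),
the tame end is untouched, and the subconvergence clause is `subconvergesLocallyTo_comp_sub`.
[cite: Anderson2004, Def. 1.1] -/
theorem isHullElement_exists_extraction : ∀ {X : Type} [TopologicalSpace X] [ChartedSpace E3 X] [IsManifold (𝓡 3) ∞ X] [T2Space X] [SecondCountableTopology X] [ConnectedSpace X] {D : InitialDataSet (𝓡 3) X} (𝒟 : VacuumCauchyDevelopment D) [𝒟.metric.HasLeviCivita] {Λ : ℝ≥0} {r₀ : ℝ} {q : ℕ → 𝒟.carrier} {𝓢 : Spacetime.{0} 4} {E : EndDatum 𝓢} {p : 𝓢.carrier}, IsHullElement 𝒟 Λ r₀ q 𝓢 E p → ∃ φ : ℕ → ℕ, StrictMono φ ∧ ∀ ρ : ℕ → ℕ, StrictMono ρ → IsHullElement 𝒟 Λ r₀ (q ∘ φ ∘ ρ) 𝓢 E p := by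
  intro X _ _ _ _ _ _ D 𝒟 _ Λ r₀ q 𝓢 E p h
  obtain ⟨Dat⟩ := h.2.2
  refine ⟨Dat.sub, Dat.strictMono_sub, fun ρ hρ ↦ ⟨?_, h.2.1, subconvergesLocallyTo_comp_sub Dat ρ hρ⟩⟩
  exact h.1.comp_tendsto (Dat.strictMono_sub.comp hρ).tendsto_atTop

end Summit.FinalStateConjecture.FinalStateConjecture.Theorems

end
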